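import Mathlib.Analysis.Calculus.ParametricIntegral
import Literature.Analysis.FunctionSpaces.TorusCalculusProofs
import Summits.AtomisticToContinuum.HydrodynamicLimit.Theorems.BoxDissipativeWeakStrongLocalGibbsFineScaleKernels
import Summits.AtomisticToContinuum.HydrodynamicLimit.Theorems.AnnealedZeroHorizonMeanFluxClosureStreamingStressCommutator
import HarnessLib

/-!
# Crux `FluxClosure` (stmt-AtomisticToContinuum-9902), line `birth` — stub B2:
# cube averages of a slab-smooth field are `C¹` along free flights

Support file (`--supports stmt-AtomisticToContinuum-9902`) proving the registered stub
`stub_boxAverageFlightDeriv` of the lead's reshaped skeleton of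
`Summit.AtomisticToContinuum.HydrodynamicLimit.Theses.BoxDissipativeWeakStrong.FluxClosure`: for the
cube kernel `K l x y = l⁻³ 𝟙[∀ i, ‖y i - x i‖ < l/2]` on `𝕋³` (`0 < l`) and a field `w : ℝ → 𝕋³ → ℝ³`
smooth on the slab `[0,T) × 𝕋³`, the tested cube average along a free flight
`s ↦ ⟪∫ K l x (q + proj ((s - t₀) • v)) • w s x dx, v⟫` is continuous on `[0,T)`, differentiable on
`(0,T)` with derivative `⟪∫ K • ∂ₜw s dx, v⟫ + Σ_{jk} v_j v_k ∫ K * ∂_k w_j(s) dx`, and the latter is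
continuous on `[0,T)`.

Proof. (i) Translation invariance of Haar measure on `𝕋³` (`integral_sub_right_eq_self`):
`K l x q' = K l 0 (x - q')`, so `∫ K l x q' • f x dx = ∫ K l 0 u • f (u + q') du` — the moving cube
becomes a FIXED bounded measurable weight against the sheared field `w s (u + q + proj ((s - t₀) • v))`.
(ii) Slab calculus: with `L = fderivWithin ℝ (stLift w) (S ×ˢ univ)` (continuous on the slab),
`∂ₜw (s, proj y) = L (s, y) (1, 0)` and `D(w s)(proj y) u = L (s, y) (0, u)`, whence joint continuity
of `w`, `∂ₜw`, `D(w ·) · v` on `S × 𝕋³` (continuity descends along the open quotient map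
`(s, y) ↦ (s, proj y)`) and the chain rule `d/ds w s (x₀ + proj ((s - t₀) • v)) = ∂ₜw + D(w s) v` at
interior times. (iii) Differentiation under `∫_{𝕋³}` (`hasDerivAt_integral_of_dominated_loc_of_deriv_le`,
derivatives bounded on compact windows `[s - δ, s + δ] × 𝕋³`) and dominated continuity
(`continuousWithinAt_of_dominated`, bound on `[0, b] × 𝕋³`, `b < T`). (iv) Identification:
`⟪D(w s)(x) v, v⟫ = Σ_{jk} v_j v_k ∂_k w_j (x)` (`StreamingStressCommutator.inner_fderiv_eq_sum`); finite
sums and scalars commute with `∫`; translate back.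

No definitions. References: H. Spohn, *Large Scale Dynamics of Interacting Particles* (1991),
Part I §3.2 (streaming term of the momentum balance); L. Grafakos, *Classical Fourier Analysis*
(3rd ed., 2014), §3.1 (calculus on `𝕋ⁿ` through periodic lifts).
-/

noncomputable section

namespace Summit.AtomisticToContinuum.HydrodynamicLimit.Theorems
namespace FluxClosureB2

open scoped BigOperators Topology Classical MeasureTheory ProbabilityTheory InnerProductSpace ENNReal
open Filter Set Function MeasureTheory
open Literature.MathematicalPhysics.KineticTheory Literature.Analysis.FluidPDE Literature.Analysis.FunctionSpaces

variable {E : Type*} [NormedAddCommGroup E] [NormedSpace ℝ E]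

omit [NormedAddCommGroup E] [NormedSpace ℝ E] in
/-- For an open quotient map `π`, `f` is continuous within `A` at `π x` iff `f ∘ π` is continuous
within `π ⁻¹' A` at `x` (`map π (𝓝 x) = 𝓝 (π x)` and `Filter.map_inf_principal_preimage`). [folklore] -/
theorem continuousWithinAt_comp_iff_of_isOpenQuotientMap {X Y : Type*} [TopologicalSpace X]
    [TopologicalSpace Y] [TopologicalSpace E] {π : X → Y} (hπ : IsOpenQuotientMap π) (f : Y → E)
    (A : Set Y) (x : X) :
    ContinuousWithinAt (f ∘ π) (π ⁻¹' A) x ↔ ContinuousWithinAt f A (π x) := by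
  simp only [ContinuousWithinAt, nhdsWithin, ← hπ.map_nhds_eq x,
    ← Filter.map_inf_principal_preimage, tendsto_map'_iff, Function.comp_def]

omit [NormedSpace ℝ E] in
/-- A function on `ℝ × 𝕋³` is continuous on the slab `S × 𝕋³` as soon as its lift along the open
quotient map `(t, y) ↦ (t, proj y)` agrees on `S × ℝ³` with a function continuous there. [folklore] -/
theorem continuousOn_slab_of_lift {S : Set ℝ} {H : ℝ × T3 → E} {g : ℝ × V3 → E}
    (hg : ContinuousOn g (S ×ˢ univ)) (hHg : ∀ t ∈ S, ∀ y : V3, H (t, Torus.proj y) = g (t, y)) :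
    ContinuousOn H (S ×ˢ univ) := by
  rintro ⟨t, x⟩ ⟨ht, -⟩
  obtain ⟨y, rfl⟩ := Torus.proj_surjective x
  have hpre : (Prod.map id Torus.proj : ℝ × V3 → ℝ × T3) ⁻¹' (S ×ˢ univ) = S ×ˢ univ := by
    ext p
    simp
  have key : ContinuousWithinAt (H ∘ Prod.map id Torus.proj) (S ×ˢ univ) (t, y) :=
    (hg (t, y) ⟨ht, mem_univ _⟩).congr (fun p hp => hHg p.1 hp.1 p.2) (hHg t ht y)
  have hiff := continuousWithinAt_comp_iff_of_isOpenQuotientMap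
    (IsOpenQuotientMap.id.prodMap Torus.isOpenQuotientMap_proj) H (S ×ˢ univ) (t, y)
  rw [hpre] at hiff
  exact hiff.1 key

/-- Joint continuity of the one-sided time derivative `∂ₜw` on `S × 𝕋³` (it lifts to
`L (s, y) (1, 0)` with `L` the continuous slab derivative of the space–time lift). [folklore] -/
theorem continuousOn_slab_timeDerivWithin {S : Set ℝ} (hU : UniqueDiffOn ℝ S) {w : ℝ → T3 → E}
    (hw : Torus.IsSmoothSpaceTimeOn S w) :
    ContinuousOn (fun p : ℝ × T3 => Torus.timeDerivWithin S w p.1 p.2) (S ×ˢ univ) := by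
  have hU' : UniqueDiffOn ℝ (S ×ˢ (univ : Set V3)) := hU.prod uniqueDiffOn_univ
  exact continuousOn_slab_of_lift
    ((hw.continuousOn_fderivWithin hU' (by simp)).clm_apply continuousOn_const)
    fun t ht y => hw.timeDerivWithin_apply_proj hU ht y

/-- The torus derivative of a slice `w t`, `t ∈ S`, is the slab derivative in space directions:
`D(w t)(proj y) u = L (t, y) (0, u)` (chain rule for `y ↦ (t, y)`, which maps `ℝ³` into the slab,
and `Torus.fderiv_lift`). [folklore] -/
theorem fderiv_slice_apply {S : Set ℝ} {w : ℝ → T3 → E} (hw : Torus.IsSmoothSpaceTimeOn S w)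
    {t : ℝ} (ht : t ∈ S) (y u : V3) :
    Torus.fderiv (w t) (Torus.proj y) u =
      fderivWithin ℝ (Torus.stLift w) (S ×ˢ univ) (t, y) (0, u) := by
  have h1 : HasFDerivWithinAt (Torus.stLift w) (fderivWithin ℝ (Torus.stLift w) (S ×ˢ univ) (t, y))
      (S ×ˢ univ) (t, y) :=
    (hw.differentiableOn (by simp) (t, y) (mk_mem_prod ht (mem_univ _))).hasFDerivWithinAt
  have h2 : HasFDerivWithinAt (Torus.lift (w t))
      ((fderivWithin ℝ (Torus.stLift w) (S ×ˢ univ) (t, y)).comp (ContinuousLinearMap.inr ℝ ℝ V3))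
      univ y :=
    h1.comp y (hasFDerivAt_prodMk_right t y).hasFDerivWithinAt
      fun _ _ => mk_mem_prod ht (mem_univ _)
  rw [← Torus.fderiv_lift, (hasFDerivWithinAt_univ.1 h2).fderiv]
  rfl

/-- Joint continuity of the space derivative along a fixed direction on `S × 𝕋³`. [folklore] -/
theorem continuousOn_slab_fderiv_apply {S : Set ℝ} (hU : UniqueDiffOn ℝ S) {w : ℝ → T3 → E}
    (hw : Torus.IsSmoothSpaceTimeOn S w) (u : V3) :
    ContinuousOn (fun p : ℝ × T3 => Torus.fderiv (w p.1) p.2 u) (S ×ˢ univ) := by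
  have hU' : UniqueDiffOn ℝ (S ×ˢ (univ : Set V3)) := hU.prod uniqueDiffOn_univ
  exact continuousOn_slab_of_lift
    ((hw.continuousOn_fderivWithin hU' (by simp)).clm_apply continuousOn_const)
    fun t ht y => fderiv_slice_apply hw ht y u

/-- **Chain rule along a free flight.** At times `t` with `S ∈ 𝓝 t` (where the space–time lift is
Fréchet differentiable with derivative the slab derivative `L`),
`d/ds w s (x₀ + proj ((s - t₀) • v)) = ∂ₜw (t, p) + D(w t)(p) v` at `p = x₀ + proj ((t - t₀) • v)`
(`L (1, v) = L (1, 0) + L (0, v)`). [folklore] -/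
theorem hasDerivAt_apply_flight {S : Set ℝ} (hU : UniqueDiffOn ℝ S) {w : ℝ → T3 → E}
    (hw : Torus.IsSmoothSpaceTimeOn S w) {t : ℝ} (ht : S ∈ 𝓝 t) (x₀ : T3) (v : V3) (t₀ : ℝ) :
    HasDerivAt (fun s => w s (x₀ + Torus.proj ((s - t₀) • v)))
      (Torus.timeDerivWithin S w t (x₀ + Torus.proj ((t - t₀) • v)) +
        Torus.fderiv (w t) (x₀ + Torus.proj ((t - t₀) • v)) v) t := by
  have htS : t ∈ S := mem_of_mem_nhds ht
  obtain ⟨y₀, rfl⟩ := Torus.proj_surjective x₀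
  have hc : HasDerivAt (fun s : ℝ => ((s, y₀ + (s - t₀) • v) : ℝ × V3)) ((1 : ℝ), v) t := by
    have h1 : HasDerivAt (fun s : ℝ => y₀ + (s - t₀) • v) v t := by
      simpa using (((hasDerivAt_id t).sub_const t₀).smul_const v).const_add y₀
    exact (hasDerivAt_id t).prodMk h1
  -- the slab is a neighbourhood of the interior point, so `stLift w` is differentiable there
  have hL : HasFDerivAt (Torus.stLift w)
      (fderivWithin ℝ (Torus.stLift w) (S ×ˢ univ) (t, y₀ + (t - t₀) • v)) (t, y₀ + (t - t₀) • v) :=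
    (hw.differentiableOn (by simp) _ (mk_mem_prod htS (mem_univ _))).hasFDerivWithinAt.hasFDerivAt
      (prod_mem_nhds ht univ_mem)
  have hcomp := hL.comp_hasDerivAt t hc
  have hfun : (Torus.stLift w ∘ fun s : ℝ => ((s, y₀ + (s - t₀) • v) : ℝ × V3)) =
      fun s => w s (Torus.proj y₀ + Torus.proj ((s - t₀) • v)) := by
    funext s
    simp [Torus.stLift]
  rw [hfun] at hcomp
  refine hcomp.congr_deriv ?_
  rw [← Torus.proj_add, hw.timeDerivWithin_apply_proj hU htS, fderiv_slice_apply hw htS, ← map_add]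
  congr 1
  simp

/-- The cube kernel is a translate of the kernel centred at `0`: `K l x y = K l 0 (x - y)`
(`‖y i - x i‖ = ‖(x - y) i‖`). [folklore] -/
theorem boxK_eq_boxK_zero_sub (l : ℝ) (x y : T3) :
    Set.indicator {y' : T3 | ∀ i, ‖y' i - x i‖ < l / 2} (fun _ => (l ^ 3)⁻¹) y =
      Set.indicator {y' : T3 | ∀ i, ‖y' i - (0 : T3) i‖ < l / 2} (fun _ => (l ^ 3)⁻¹) (x - y) := by
  have h : y ∈ {y' : T3 | ∀ i, ‖y' i - x i‖ < l / 2} ↔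
      x - y ∈ {y' : T3 | ∀ i, ‖y' i - (0 : T3) i‖ < l / 2} := by
    simp only [mem_setOf_eq, Pi.sub_apply, Pi.zero_apply, sub_zero]
    exact forall_congr' fun i => by rw [norm_sub_rev]
  by_cases hy : y ∈ {y' : T3 | ∀ i, ‖y' i - x i‖ < l / 2}
  · rw [indicator_of_mem hy, indicator_of_mem (h.1 hy)]
  · rw [indicator_of_notMem hy, indicator_of_notMem (mt h.2 hy)]

/-- `‖K l x y‖ ≤ l⁻³` for `0 ≤ l`. [folklore] -/
theorem norm_boxK_le {l : ℝ} (hl : 0 ≤ l) (x y : T3) :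
    ‖Set.indicator {y' : T3 | ∀ i, ‖y' i - x i‖ < l / 2} (fun _ => (l ^ 3)⁻¹) y‖ ≤ (l ^ 3)⁻¹ := by
  rw [Real.norm_eq_abs, abs_of_nonneg (LGFS.boxK_nonneg hl x y)]
  exact LGFS.boxK_le hl x y

/-- The cube kernel is measurable in its centre variable `x` (for fixed `y`). [folklore] -/
theorem measurable_boxK_left (l : ℝ) (y : T3) :
    Measurable fun x : T3 =>
      Set.indicator {y' : T3 | ∀ i, ‖y' i - x i‖ < l / 2} (fun _ => (l ^ 3)⁻¹) y := by
  have h : (fun x : T3 =>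
      Set.indicator {y' : T3 | ∀ i, ‖y' i - x i‖ < l / 2} (fun _ => (l ^ 3)⁻¹) y) =
      (fun u : T3 =>
        Set.indicator {y' : T3 | ∀ i, ‖y' i - (0 : T3) i‖ < l / 2} (fun _ => (l ^ 3)⁻¹) u) ∘
        fun x => x - y := funext fun x => boxK_eq_boxK_zero_sub l x y
  rw [h]
  exact (LGFS.measurable_boxK_right l 0).comp (measurable_id.sub_const y)

/-- **Translation.** By invariance of Haar measure on `𝕋³`, the cube average of `f` around `q'`
is the average of the translate `f (· + q')` against the fixed cube centred at `0`:
`∫ K l x q' • f x dx = ∫ K l 0 u • f (u + q') du`. [folklore] -/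
theorem integral_boxK_smul (l : ℝ) (q' : T3) (f : T3 → E) :
    ∫ x, Set.indicator {y' : T3 | ∀ i, ‖y' i - x i‖ < l / 2} (fun _ => (l ^ 3)⁻¹) q' • f x =
      ∫ u, Set.indicator {y' : T3 | ∀ i, ‖y' i - (0 : T3) i‖ < l / 2} (fun _ => (l ^ 3)⁻¹) u •
        f (u + q') := by
  have h := integral_sub_right_eq_self (μ := (volume : Measure T3))
    (fun u => Set.indicator {y' : T3 | ∀ i, ‖y' i - (0 : T3) i‖ < l / 2} (fun _ => (l ^ 3)⁻¹) u •
      f (u + q')) q'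
  simp only [sub_add_cancel] at h
  rw [← h]
  congr 1
  funext x
  rw [boxK_eq_boxK_zero_sub l x q']

/-- A bounded measurable weight times a continuous field on `𝕋³` is integrable. [folklore] -/
theorem integrable_kernel_smul {φ : T3 → ℝ} (hφm : Measurable φ) {C : ℝ} (hφC : ∀ u, ‖φ u‖ ≤ C)
    {g : T3 → E} (hg : Continuous g) : Integrable (fun u => φ u • g u) :=
  hg.integrable_unitAddTorus.bdd_smul C hφm.aestronglyMeasurable (ae_of_all _ hφC)

/-- The quadratic form of the weighted space derivative in coordinates: for a bounded measurable
weight `φ` and a smooth field `f`,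
`⟪∫ φ x • Df(x) v dx, v⟫ = Σ_{jk} v_j v_k ∫ φ x * ∂_k f_j (x) dx`. [folklore] -/
theorem inner_integral_kernel_smul_fderiv {φ : T3 → ℝ} (hφm : Measurable φ) {C : ℝ}
    (hφC : ∀ u, ‖φ u‖ ≤ C) {f : T3 → V3} (hf : Torus.IsSmooth f) (v : V3) :
    ⟪∫ x, φ x • Torus.fderiv f x v, v⟫_ℝ =
      ∑ j, ∑ k, v j * v k * ∫ x, φ x * Torus.partialDeriv k (fun y => f y j) x := by
  have hDc : Continuous fun x => Torus.fderiv f x v :=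
    (Torus.continuous_fderiv (hf.isContDiff (by simp))).clm_apply continuous_const
  have hPc : ∀ j k : Fin 3, Continuous (Torus.partialDeriv k fun y => f y j) := fun j k =>
    ((hf.apply j).partialDeriv k).continuous
  have hint : ∀ j k : Fin 3,
      Integrable fun x => v j * v k * (φ x * Torus.partialDeriv k (fun y => f y j) x) :=
    fun j k => by
      simpa only [smul_eq_mul] using
        (integrable_kernel_smul hφm hφC (hPc j k)).const_mul (v j * v k)
  rw [real_inner_comm, ← integral_inner (integrable_kernel_smul hφm hφC hDc) v]
  have hpt : ∀ x, ⟪v, φ x • Torus.fderiv f x v⟫_ℝ =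
      ∑ j, ∑ k, v j * v k * (φ x * Torus.partialDeriv k (fun y => f y j) x) := by
    intro x
    rw [real_inner_smul_right, real_inner_comm,
      StreamingStressCommutator.inner_fderiv_eq_sum hf x v, Finset.mul_sum]
    refine Finset.sum_congr rfl fun j _ => ?_
    rw [Finset.mul_sum]
    refine Finset.sum_congr rfl fun k _ => ?_
    ring
  simp_rw [hpt]
  rw [integral_finsetSum _ fun j _ => integrable_finsetSum _ fun k _ => hint j k]
  refine Finset.sum_congr rfl fun j _ => ?_
  rw [integral_finsetSum _ fun k _ => hint j k]
  refine Finset.sum_congr rfl fun k _ => ?_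
  exact integral_const_mul _ _

/-- **Dominated continuity.** For a bounded measurable weight `φ` and `G` jointly continuous on
`[0,T) × 𝕋³`, `s ↦ ∫ φ u • G (s, u) du` is continuous on `[0,T)` (bound on the compact sub-slab
`[0, b] × 𝕋³`, `s₀ < b < T`). [folklore] -/
theorem continuousOn_integral_smul_Ico {φ : T3 → ℝ} (hφm : Measurable φ) {C : ℝ}
    (hφC : ∀ u, ‖φ u‖ ≤ C) {T : ℝ} {G : ℝ → T3 → E}
    (hG : ContinuousOn (fun p : ℝ × T3 => G p.1 p.2) (Ico 0 T ×ˢ univ)) :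
    ContinuousOn (fun s => ∫ u, φ u • G s u) (Ico 0 T) := by
  intro s₀ hs₀
  have hs₀b : s₀ < (s₀ + T) / 2 := by linarith [hs₀.2]
  have hbT : (s₀ + T) / 2 < T := by linarith [hs₀.2]
  have hsub : Icc 0 ((s₀ + T) / 2) ×ˢ (univ : Set T3) ⊆ Ico 0 T ×ˢ univ :=
    prod_mono (fun s hs => ⟨hs.1, hs.2.trans_lt hbT⟩) Subset.rfl
  obtain ⟨M, hM⟩ := (isCompact_Icc.prod isCompact_univ).exists_bound_of_continuousOn (hG.mono hsub)
  have hC0 : 0 ≤ C := (norm_nonneg _).trans (hφC 0)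
  have hnear : ∀ᶠ s in 𝓝[Ico 0 T] s₀, s ∈ Ico 0 T ∧ s < (s₀ + T) / 2 :=
    eventually_mem_nhdsWithin.and (mem_nhdsWithin_of_mem_nhds (Iio_mem_nhds hs₀b))
  have hslice : ∀ s ∈ Ico 0 T, Continuous fun u => G s u := fun s hs =>
    hG.comp_continuous (Continuous.prodMk_right s) fun u => ⟨hs, mem_univ _⟩
  refine continuousWithinAt_of_dominated (bound := fun _ => C * M) ?_ ?_ (integrable_const _) ?_
  · filter_upwards [hnear] with s hs
    exact hφm.aestronglyMeasurable.smul (hslice s hs.1).aestronglyMeasurable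
  · filter_upwards [hnear] with s hs
    refine ae_of_all _ fun u => ?_
    rw [norm_smul]
    exact mul_le_mul (hφC u) (hM (s, u) ⟨⟨hs.1.1, hs.2.le⟩, mem_univ _⟩) (norm_nonneg _) hC0
  · refine ae_of_all _ fun u => ?_
    have h2 : ContinuousWithinAt (fun s : ℝ => ((s, u) : ℝ × T3)) (Ico 0 T) s₀ :=
      (Continuous.prodMk_left u).continuousWithinAt
    have h1 : ContinuousWithinAt (fun s => G s u) (Ico 0 T) s₀ :=
      (hG (s₀, u) ⟨hs₀, mem_univ _⟩).comp (f := fun s : ℝ => ((s, u) : ℝ × T3)) h2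
        fun s hs => ⟨hs, mem_univ _⟩
    exact h1.const_smul (φ u)

/-- **Differentiation under `∫_{𝕋³}`.** For a bounded measurable weight `φ`, slices `G s`
continuous for `s ∈ (0,T)`, `s ↦ G (s, u)` differentiable on `(0,T)` with derivative `G' (s, u)`,
and `G'` jointly continuous on `(0,T) × 𝕋³`: `d/ds ∫ φ u • G (s, u) du = ∫ φ u • G' (s₀, u) du` at
every `s₀ ∈ (0,T)` (derivatives bounded on the compact window `[s₀ - δ, s₀ + δ] × 𝕋³`). [folklore] -/
theorem hasDerivAt_integral_smul_Ioo {φ : T3 → ℝ} (hφm : Measurable φ) {C : ℝ}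
    (hφC : ∀ u, ‖φ u‖ ≤ C) {T : ℝ} {G G' : ℝ → T3 → E} (hG : ∀ s ∈ Ioo 0 T, Continuous (G s))
    (hG' : ContinuousOn (fun p : ℝ × T3 => G' p.1 p.2) (Ioo 0 T ×ˢ univ))
    (hd : ∀ u, ∀ s ∈ Ioo 0 T, HasDerivAt (fun s => G s u) (G' s u) s) {s₀ : ℝ}
    (hs₀ : s₀ ∈ Ioo 0 T) :
    HasDerivAt (fun s => ∫ u, φ u • G s u) (∫ u, φ u • G' s₀ u) s₀ := by
  obtain ⟨δ, hδ, hI⟩ : ∃ δ > 0, Icc (s₀ - δ) (s₀ + δ) ⊆ Ioo 0 T := by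
    have h1 : 0 < min s₀ (T - s₀) := lt_min hs₀.1 (sub_pos.2 hs₀.2)
    refine ⟨min s₀ (T - s₀) / 2, half_pos h1, fun s hs => ⟨?_, ?_⟩⟩
    · have := min_le_left s₀ (T - s₀)
      linarith [hs.1]
    · have := min_le_right s₀ (T - s₀)
      linarith [hs.2]
  have hball : Metric.ball s₀ δ ⊆ Icc (s₀ - δ) (s₀ + δ) := fun s hs => by
    rw [Real.ball_eq_Ioo] at hs
    exact ⟨hs.1.le, hs.2.le⟩
  obtain ⟨M, hM⟩ := (isCompact_Icc.prod isCompact_univ).exists_bound_of_continuousOn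
    (hG'.mono (prod_mono hI Subset.rfl))
  have hC0 : 0 ≤ C := (norm_nonneg _).trans (hφC 0)
  have hslice : Continuous fun u => G' s₀ u :=
    hG'.comp_continuous (Continuous.prodMk_right s₀) fun u => ⟨hs₀, mem_univ _⟩
  refine (hasDerivAt_integral_of_dominated_loc_of_deriv_le (μ := (volume : Measure T3))
    (F := fun s u => φ u • G s u) (F' := fun s u => φ u • G' s u) (bound := fun _ => C * M)
    (Metric.ball_mem_nhds s₀ hδ) ?_ ?_ ?_ ?_ (integrable_const _) ?_).2
  · filter_upwards [Ioo_mem_nhds hs₀.1 hs₀.2] with s hs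
    exact hφm.aestronglyMeasurable.smul (hG s hs).aestronglyMeasurable
  · exact integrable_kernel_smul hφm hφC (hG s₀ hs₀)
  · exact hφm.aestronglyMeasurable.smul hslice.aestronglyMeasurable
  · refine ae_of_all _ fun u s hs => ?_
    rw [norm_smul]
    exact mul_le_mul (hφC u) (hM (s, u) ⟨hball hs, mem_univ _⟩) (norm_nonneg _) hC0
  · exact ae_of_all _ fun u s hs => (hd u s (hI (hball hs))).const_smul (φ u)

/-- **Stub B2 (`FluxClosure`, line `birth`): cube averages of a slab-smooth field are `C¹` along
free flights.** For the cube kernel `K l x y = l⁻³ 𝟙[∀ i, ‖y i - x i‖ < l/2]` (`0 < l`), `w` smooth on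
`[0,T) × 𝕋³`, a point `q`, velocity `v` and time origin `t₀`, the tested cube average
`s ↦ ⟪∫ K l x (q + proj ((s - t₀) • v)) • w s x dx, v⟫` is continuous on `[0,T)`, has at every
`s ∈ (0,T)` the derivative `⟪∫ K • ∂ₜw s dx, v⟫ + Σ_{jk} v_j v_k ∫ K * ∂_k w_j (s) dx` (box averages of
`∂ₜw + (v·∇)w`; `Torus.timeDerivWithin (Ico 0 T)` is two-sided on `(0,T)`), and this derivative is
continuous on `[0,T)` (Spohn 1991, Part I §3.2, streaming term of the momentum balance). -/
theorem stub_boxAverageFlightDeriv : ∀ (l T : ℝ), 0 < l → ∀ w : ℝ → T3 → V3, Torus.IsSmoothSpaceTimeOn (Ico 0 T) w → let K := fun (l : ℝ) (x y : T3) => indicator {y' : T3 | ∀ i, ‖y' i - x i‖ < l / 2} (fun _ => (l ^ 3)⁻¹) y; ∀ (q : T3) (v : V3) (t₀ : ℝ), ContinuousOn (fun s => inner ℝ (∫ x, K l x (q + Torus.proj ((s - t₀) • v)) • w s x) v) (Ico 0 T) ∧ (∀ s ∈ Ioo 0 T, HasDerivAt (fun s => inner ℝ (∫ x, K l x (q +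 Torus.proj ((s - t₀) • v)) • w s x) v) (inner ℝ (∫ x, K l x (q + Torus.proj ((s - t₀) • v)) • Torus.timeDerivWithin (Ico 0 T) w s x) v + ∑ j, ∑ k, v j * v k * ∫ x, K l x (q + Torus.proj ((s - t₀) • v)) * Torus.partialDeriv k (fun y => w s y j) x) s) ∧ ContinuousOn (fun s => inner ℝ (∫ x, K l x (q + Torus.proj ((s - t₀) • v)) • Torus.timeDerivWithin (Ico 0 T) w s x) v + ∑ j, ∑ k, v j * v k * ∫ x, K l x (q + Torus.proj ((s - t₀) • v)) * Torus.partialDeriv k (fun y => w s y j) x) (Ico 0 T) := by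
  intro l T hl w hw
  dsimp only
  intro q v t₀
  -- the fixed weight `φ = K l 0`: measurable and bounded by `l⁻³`
  have hφm := LGFS.measurable_boxK_right l 0
  have hφC := fun u : T3 => norm_boxK_le hl.le 0 u
  have hU : UniqueDiffOn ℝ (Ico 0 T) := uniqueDiffOn_Ico 0 T
  -- the shear `(s, u) ↦ (s, u + q(s))`, `q(s) = q + proj ((s - t₀) • v)`, preserves the slab
  have hψc : Continuous fun p : ℝ × T3 =>
      ((p.1, p.2 + (q + Torus.proj ((p.1 - t₀) • v))) : ℝ × T3) :=
    continuous_fst.prodMk (continuous_snd.add (continuous_const.add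
      (Torus.continuous_proj.comp ((continuous_fst.sub continuous_const).smul continuous_const))))
  have hψm : MapsTo (fun p : ℝ × T3 => ((p.1, p.2 + (q + Torus.proj ((p.1 - t₀) • v))) : ℝ × T3))
      (Ico 0 T ×ˢ univ) (Ico 0 T ×ˢ univ) := fun p hp => ⟨hp.1, mem_univ _⟩
  -- joint continuity on the slab of `w` (its lift IS `stLift w`), hence of the sheared field, and
  -- of the flight derivative of the latter
  have hG : ContinuousOn (fun p : ℝ × T3 => w p.1 (p.2 + (q + Torus.proj ((p.1 - t₀) • v))))
      (Ico 0 T ×ˢ univ) :=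
    (continuousOn_slab_of_lift (H := fun p : ℝ × T3 => w p.1 p.2) hw.continuousOn
      fun _ _ _ => rfl).comp hψc.continuousOn hψm
  have hG' : ContinuousOn (fun p : ℝ × T3 =>
      Torus.timeDerivWithin (Ico 0 T) w p.1 (p.2 + (q + Torus.proj ((p.1 - t₀) • v))) +
        Torus.fderiv (w p.1) (p.2 + (q + Torus.proj ((p.1 - t₀) • v))) v) (Ico 0 T ×ˢ univ) :=
    ((continuousOn_slab_timeDerivWithin hU hw).add (continuousOn_slab_fderiv_apply hU hw v)).comp
      hψc.continuousOn hψm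
  -- (1), (3'): dominated continuity on `[0,T)`; (2'): differentiation under `∫` on `(0,T)`
  have h1 := continuousOn_integral_smul_Ico
    (G := fun s u => w s (u + (q + Torus.proj ((s - t₀) • v)))) hφm hφC hG
  have h3 := continuousOn_integral_smul_Ico (G := fun s u =>
    Torus.timeDerivWithin (Ico 0 T) w s (u + (q + Torus.proj ((s - t₀) • v))) +
      Torus.fderiv (w s) (u + (q + Torus.proj ((s - t₀) • v))) v) hφm hφC hG'
  have h2 : ∀ s ∈ Ioo 0 T, HasDerivAt
      (fun s => ∫ u,
        Set.indicator {y' : T3 | ∀ i, ‖y' i - (0 : T3) i‖ < l / 2} (fun _ => (l ^ 3)⁻¹) u •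
          w s (u + (q + Torus.proj ((s - t₀) • v))))
      (∫ u, Set.indicator {y' : T3 | ∀ i, ‖y' i - (0 : T3) i‖ < l / 2} (fun _ => (l ^ 3)⁻¹) u •
        (Torus.timeDerivWithin (Ico 0 T) w s (u + (q + Torus.proj ((s - t₀) • v))) +
          Torus.fderiv (w s) (u + (q + Torus.proj ((s - t₀) • v))) v)) s := by
    intro s hs
    refine hasDerivAt_integral_smul_Ioo hφm hφC
      (G := fun s u => w s (u + (q + Torus.proj ((s - t₀) • v))))
      (G' := fun s u => Torus.timeDerivWithin (Ico 0 T) w s (u + (q + Torus.proj ((s - t₀) • v))) +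
        Torus.fderiv (w s) (u + (q + Torus.proj ((s - t₀) • v))) v) ?_ ?_ ?_ hs
    · intro s' hs'
      exact hG.comp_continuous (Continuous.prodMk_right s')
        fun u => ⟨Ioo_subset_Ico_self hs', mem_univ _⟩
    · exact hG'.mono (prod_mono Ioo_subset_Ico_self Subset.rfl)
    · intro u s' hs'
      simpa only [add_assoc] using
        hasDerivAt_apply_flight hU hw (Ico_mem_nhds hs'.1 hs'.2) (u + q) v t₀
  -- identification of the derivative with the registered expression, for `s ∈ [0,T)`
  have hE : ∀ s ∈ Ico 0 T,
      ⟪∫ u, Set.indicator {y' : T3 | ∀ i, ‖y' i - (0 : T3) i‖ < l / 2} (fun _ => (l ^ 3)⁻¹) u •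
        (Torus.timeDerivWithin (Ico 0 T) w s (u + (q + Torus.proj ((s - t₀) • v))) +
          Torus.fderiv (w s) (u + (q + Torus.proj ((s - t₀) • v))) v), v⟫_ℝ =
      ⟪∫ x, Set.indicator {y' : T3 | ∀ i, ‖y' i - x i‖ < l / 2} (fun _ => (l ^ 3)⁻¹)
          (q + Torus.proj ((s - t₀) • v)) • Torus.timeDerivWithin (Ico 0 T) w s x, v⟫_ℝ +
        ∑ j, ∑ k, v j * v k * ∫ x, Set.indicator {y' : T3 | ∀ i, ‖y' i - x i‖ < l / 2}
          (fun _ => (l ^ 3)⁻¹) (q + Torus.proj ((s - t₀) • v)) *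
            Torus.partialDeriv k (fun y => w s y j) x := by
    intro s hs
    have hsm : Torus.IsSmooth (w s) := hw.isSmooth_slice hs
    have htc : Continuous (Torus.timeDerivWithin (Ico 0 T) w s) :=
      (hw.isSmooth_timeDerivWithin hU hs).continuous
    have hfc : Continuous fun x => Torus.fderiv (w s) x v :=
      (Torus.continuous_fderiv (hsm.isContDiff (by simp))).clm_apply continuous_const
    have hKm := measurable_boxK_left l (q + Torus.proj ((s - t₀) • v))
    have hKC := fun x => norm_boxK_le hl.le x (q + Torus.proj ((s - t₀) • v))
    rw [← integral_boxK_smul l (q + Torus.proj ((s - t₀) • v))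
      (fun x => Torus.timeDerivWithin (Ico 0 T) w s x + Torus.fderiv (w s) x v)]
    simp_rw [smul_add]
    rw [integral_add (integrable_kernel_smul hKm hKC htc) (integrable_kernel_smul hKm hKC hfc),
      inner_add_left, inner_integral_kernel_smul_fderiv hKm hKC hsm v]
  -- translation of the averaged field itself, then assembly
  have eW : ∀ s : ℝ, (∫ x, Set.indicator {y' : T3 | ∀ i, ‖y' i - x i‖ < l / 2} (fun _ => (l ^ 3)⁻¹)
      (q + Torus.proj ((s - t₀) • v)) • w s x) =
      ∫ u, Set.indicator {y' : T3 | ∀ i, ‖y' i - (0 : T3) i‖ < l / 2} (fun _ => (l ^ 3)⁻¹) u •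
        w s (u + (q + Torus.proj ((s - t₀) • v))) :=
    fun s => integral_boxK_smul l _ (w s)
  simp_rw [eW]
  refine ⟨h1.inner continuousOn_const, fun s hs => ?_, ?_⟩
  · have hd := (h2 s hs).inner ℝ (hasDerivAt_const s v)
    rw [inner_zero_right, zero_add] at hd
    exact hd.congr_deriv (hE s (Ioo_subset_Ico_self hs))
  · exact (h3.inner continuousOn_const).congr fun s hs => (hE s hs).symm

end FluxClosureB2
end Summit.AtomisticToContinuum.HydrodynamicLimit.Theorems
end
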